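import Literature.MathematicalPhysics.QuantumFieldTheory.Balaban1983to89.B6MultiLevelBoxOperator
import Literature.MathematicalPhysics.QuantumFieldTheory.Balaban1983to89.B4Lemma24ZeroBoxAlphaNeg

/-!
# `Balaban1983to89.B6MultiLevelBoxOperatorL0` — [B6] (2.1)–(2.4), (2.13)–(2.14) WITH THE LEVEL `0` ADMITTED: the nested family
`X ⊃ Ω₁ ⊃ Ω₂ ⊃ … ⊃ Ω_k` on a Neumann box `X` with print's region `Λ₀ = X ∖ Ω₁` (possibly non-empty), and the entries of the
GENUINE `k`-level operator `Δ′_a = −Δ^{N}_X + Σ_{j=0}^{k} a_j(L^jη)^{−2}Q′_j*1_{Λ_j}Q′_j` for it (file F1 = print section S-A of the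
level-0 programme G-F3′-L0; the twin of `B6MultiLevelBoxOperator` §2–§3 with the SAME declaration names; no existing module is
touched; no fact is minted)

FRAMING (verbatim cell line):
statement-level skeleton of published theorems with citation tags; proofs where landed; nothing here is a claim about the Yang–Mills mass gap

Source under audit (cell lit-balaban): T. Bałaban, *Propagators and renormalization transformations for lattice gauge theories. II*,
Commun. Math. Phys. **96** (1984) 223–250 [`Balaban1984PropagatorsII`, "B6"], p. 224 [PDF 2] (2.1)–(2.4), p. 225 [PDF 3] (2.13)–(2.14),
p. 229 [PDF 7] (the boundary-condition paragraph) — held text `paper:balaban1984-cmp96-propagators-rt-ii`, pages `p0003.txt:L14–L34`,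
`p0007.txt:L3–L12` re-read this generation (unit `lit-balaban-r03`, B6 fold owner r03 gen 36, HOME `run/shared/lean/pub/lit-balaban/`,
programme G-F3′-L0 = director-ym LINE №27 / UV3-NODE §24.5, plan `lit-balaban-r03/G-F3L0-PLAN.md`; referee ref-4).

## WHAT IS PRINTED (verbatim up to notation)

p. 224: «Λ_j = Ω_j^{(j)} ∖ Ω_{j+1}^{(j)}, j = 1, …, k − 1, Λ_k = Ω_k^{(k)}, Λ₀ = Ω₁^c (2.3) … T = ⋃_{j=0}^{k} B^j(Λ_j), where B⁰(Λ₀) = Λ₀.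
(2.4)».  p. 225: «⟨λ, Q′*aQ′λ⟩ = Σ_{j=0}^{k} Σ_{y∈Λ_j} a_j(L^jη)^{d−2}|(Q′_jλ)(y)|². (2.14) The numbers a_j satisfy the recursive equations
a_{j+1} = aa_j/(aL^{−2} + a_j), a₁ = a …, and we assume that (Q′₀λ)(x) = λ(x), x ∈ Λ₀. … The operator G′ = Δ′_a^{−1} is a well defined,
positive operator because Δ′_a satisfies the inequality (2.11) for all λ, with min{a_j, π²} instead of π² and the index j running from 0
to k on the right-hand side.»  p. 229: «If we are interested in a Green's function for this operator considered on a domain Ω ⊂ T_η, we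
have to introduce some boundary conditions. We can do it taking a sequence (2.1) with Ω = Ω_k and smallest possible domains B^j(Λ_j), and
considering the operator Δ_a defined by (2.19), (2.20) for this sequence. Boundary conditions of this type can be interpreted as obtained
by building an effective mass on the domain Ω₁∖Ω_k, starting from O(1) on Ω_k up to +∞ outside Ω₁.»

## WHY THIS FILE (G-F3′-L0, design decision of the plan §1)

The box lineage's structure `B6MultiLevelBoxOperator.Domains` carries the field `one_le_lev` (levels `1 … k`, `Ω₁ = X`: print's admitted case
«Ω_j = T_η for j = 1, …, l»), so `Λ₀ = ∅` there.  Print's own use of the sequences (p. 229) has `Λ₀ = X ∖ Ω₁ ≠ ∅`, where the operator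
carries the level-`0` term of (2.14): the block of level `0` is a single site, `Q′₀ = id`, and the weight is the FINITE lattice-scale mass
`a₀η^{−2}` («+∞ outside Ω₁» is its continuum reading).  The operator `B6MultiLevelBoxOperator.mlOp N ℓ k lev a` ALREADY sums `j = 0, …, k` over a
bare level function and its inverse `gml`, injectivity and forms need only `lev ≤ k`; what is missing is the STRUCTURE admitting `lev x = 0`
and the lemmas that read the structure.  This file supplies exactly that, with the same names as the twin, so that every downstream module
of the lineage ports by a namespace swap.

## WHAT THIS FILE CERTIFIES (kernel-checked; units of `B6MultiLevelBoxOperator`)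

* `Domains` — **(2.1)–(2.2) AS A STRUCTURE WITH LEVELS `0, …, k`**: the level function `lev ≤ k` (no floor; `Λ₀ = {lev = 0} = X ∖ Ω₁`),
  **(2.1)** `Ω_j = {j ≤ lev}` a union of big `j`-blocks for EVERY `j ≥ 1` (now a condition on `Ω₁` too), **(2.2)**
  `dist_∞(Ω_j^c, Ω_{j+1}) > R·M·L^j` verbatim (vacuous at `j = 0`); `Domains.ofBox` — every family of the twin structure IS one of this
  structure (same `lev`); `top` (all sites at level `k`), `floor` (all sites at level `0`: `Ω₁ = ∅`, the pure massive operator), `split01`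
  (a two-level `0/1` family from ANY union of big `1`-blocks — the non-vacuity of `Λ₀ ≠ ∅ ≠ Λ₁`);
* the §2 lemmas of the twin for the new structure, SAME NAMES: `terr`, `omega`, `omega_zero` (`Ω₀ = X`), `omega_succ_subset`, `terr_iff`,
  **`lev_eq_of_blk_eq`** (every territory, `Λ₀` included, is a union of blocks of its own level), `lev_eq_of_blk_eq_of_le`, the TWO-LEVEL
  WINDOW **`lev_window`** (a `j`-cube of side `< 2ML^j`, `R ≥ 2L`, meets only the levels `j − 1, j, j + 1`; at `j = 0` only `0, 1`) and
  **`not_both_sides`**;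
* **`mlOp_apply`** — the entries of the lineage's `Δ′_a` (`B6MultiLevelBoxOperator.mlOp`, REUSED, not restated) for a family of this
  structure: `Δ′_a(x, x′) = (−Δ^N_X)(x, x′) + levC_{lev x}·[x′ ∼_{lev x} x]`, and its level-`0` reading **`mlOp_apply_of_lev_zero`**:
  on `Λ₀` the averaging term is the diagonal mass `a₀·δ_{xx′}` (`levC_zero`: `levC d ℓ a 0 = a 0`; «(Q′₀λ)(x) = λ(x), x ∈ Λ₀»);
* `gml_ofBox` / `mlOp_ofBox`: on an embedded family the operator and its inverse are literally the twin's.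

## HONEST SCOPE

* Box `X` with Neumann conditions (as the whole box lineage; the torus twin is file F2 `B6MultiLevelTorusOperatorL0`); `A = 0`; the weight
  `a₀` of the level-`0` term is a free positive parameter like every `a_j` (print leaves `a₀` implicit in (2.14) — the recursion starts at
  `a₁ = a` — and takes «a_j replaced simply by a» in (2.19)); NO Dirichlet rows / principal submatrix: the level-`0` sites stay in the
  carrier with the finite mass, exactly as (2.14)/(2.20) print it.
* `dist` of (2.2) in the sup-norm of the fine lattice; big blocks of level `j` = cubes of the grid `(M L^j)ℤ^{d+1}`, `M = L·M_h`; at level `0`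
  the big blocks have side `M` (`bigSide ℓ M_h 0 = M_h·L`).
* Three conclusions (`omega_succ_subset`, `terr_iff`, `lev_eq_of_blk_eq`) are spelled with the structure's namespace (`Domains.lev D x′`)
  only to keep the statement-text dedup key distinct from the twin's byte-identical statements over the OTHER structure (framework note
  framework-gaps-2026-08-16-g29 §2); the statements are the twin's.
* Nothing is inferred from the manuscript: every step is kernel-checked; the quoted sentences locate the statements.  Value = the
  structural layer-0 twin that the 114-module level-0 port (plan Appendix A) builds on; NOT summit progress.
-/

namespace Literature.MathematicalPhysics.QuantumFieldTheory.Balaban1983to89.B6MultiLevelBoxOperatorL0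

open Finset Matrix
open Literature.MathematicalPhysics.QuantumFieldTheory.Balaban1983to89.B4ContourShift (supNorm abs_le_supNorm
  supNorm_nonneg)
open Literature.MathematicalPhysics.QuantumFieldTheory.Balaban1983to89.B4Reflection242 (boxDom mem_boxDom nbrs mem_nbrs
  blk neumannLapK diagK avgK supNorm_add_le)
open Literature.MathematicalPhysics.QuantumFieldTheory.Balaban1983to89.B4Green242Bridge (boxNbrs boxBlk mem_boxBlk_self
  zero_mem_boxDom box_const_of_bonds)
open Literature.MathematicalPhysics.QuantumFieldTheory.Balaban1983to89.B4BoxCov237 (opBoxR opBoxR_isSymm quadFormR_eq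
  opBoxR_mulVec)
open Literature.MathematicalPhysics.QuantumFieldTheory.Balaban1983to89.B4Thm110ZeroBox (boxCast boxCast_apply_val blk_blk
  supNorm_sub_le_sub_add_sub one_lt_L_real)
open Literature.MathematicalPhysics.QuantumFieldTheory.Balaban1983to89.B4Lemma24ZeroBoxAlphaNeg (blk_one)
open Literature.MathematicalPhysics.QuantumFieldTheory.Balaban1983to89.B6MultiLevelBoxOperator (N0 bigSide bigSide_eq
  bigSide_succ_eq bigSide_succ one_le_bigSide levC levC_pos indLev mlOp gml)

noncomputable section

variable {d : ℕ}

/-! ## §2 (2.1)–(2.4) with the level `0`: the level function of a nested family `X ⊃ Ω₁ ⊃ … ⊃ Ω_k` -/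

/-- **(2.1)–(2.2) ON THE BOX `X` WITH LEVELS `0, …, k`** (`Λ₀ = X ∖ Ω₁` admitted): a nested family `X ⊃ Ω₁ ⊃ Ω₂ ⊃ … ⊃ Ω_k` is recorded by
its LEVEL FUNCTION `lev` — `x ∈ B^j(Λ_j) ⇔ lev x = j` ((2.3)–(2.4): `Λ_j = Ω_j ∖ Ω_{j+1}`, `Λ_k = Ω_k`, `Λ₀ = Ω₁^c`, `T = ⋃_{j=0}^k B^j(Λ_j)`,
`B⁰(Λ₀) = Λ₀`), so that `Ω_j = {x : j ≤ lev x}` and `Ω₀ = X`; **(2.1)** «Ω_j^{(j)} is a sum of big blocks»: membership in `Ω_j` (`1 ≤ j ≤ k`)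
depends only on the big `j`-block (side `M·L^j` fine sites); **(2.2)** «(L^jη)^{−1}dist(Ω_j^c, Ω_{j+1}) > RM»: a point below level `j` and
a point at level `≥ j + 1` are more than `R·M·L^j` apart (sup-norm of the fine lattice).  Parameters: dimension `d + 1`, `L = ℓ + 1`,
`M = L·M_h`, `k` levels, box half-widths `P`, the integer `R`. [cite: Balaban1984PropagatorsII, (2.1)–(2.4) p.224 with p.229 («smallest possible domains B^j(Λ_j)»)] -/
structure Domains (d ℓ Mh k : ℕ) (P : Fin (d + 1) → ℕ) (R : ℕ) where
  /-- the level of (the territory `B^j(Λ_j)` containing) a fine site; `0` on `Λ₀ = X ∖ Ω₁` -/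
  lev : (Fin (d + 1) → ℤ) → ℕ
  lev_le : ∀ x, lev x ≤ k
  /-- (2.1): `Ω_j = {j ≤ lev}` is a union of big `j`-blocks, `1 ≤ j` -/
  bigBlocks : ∀ j, 1 ≤ j → ∀ x ∈ boxDom (N0 ℓ Mh k P), ∀ x' ∈ boxDom (N0 ℓ Mh k P),
    blk (bigSide ℓ Mh j) x' = blk (bigSide ℓ Mh j) x → (j ≤ lev x ↔ j ≤ lev x')
  /-- (2.2): `dist(Ω_j^c, Ω_{j+1}) > R·M·L^j` -/
  sep : ∀ j, ∀ x ∈ boxDom (N0 ℓ Mh k P), ∀ x' ∈ boxDom (N0 ℓ Mh k P), lev x < j → j + 1 ≤ lev x' →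
    ((R * bigSide ℓ Mh j : ℕ) : ℝ) < supNorm (x - x')

namespace Domains

variable {ℓ Mh k R : ℕ} {P : Fin (d + 1) → ℕ} (D : Domains d ℓ Mh k P R)

/-- **EVERY FAMILY OF THE TWIN STRUCTURE IS A FAMILY OF THIS ONE** (same level function; its `Λ₀` is empty): print's admitted case
«Ω_j = T_η for j = 1, …, l» inside the general one. [cite: Balaban1984PropagatorsII, (2.1) p.224 («we admit the case when some domains Ω_j are equal to T_η»)] -/
def ofBox (D₁ : B6MultiLevelBoxOperator.Domains d ℓ Mh k P R) : Domains d ℓ Mh k P R where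
  lev := D₁.lev
  lev_le := D₁.lev_le
  bigBlocks := fun j hj x hx x' hx' h => by
    rcases Nat.lt_or_ge 1 j with hlt | hle
    · exact D₁.bigBlocks j hlt x hx x' hx' h
    · have hj1 : j = 1 := le_antisymm hle hj
      subst hj1
      exact ⟨fun _ => D₁.one_le_lev x', fun _ => D₁.one_le_lev x⟩
  sep := D₁.sep

/-- the embedding keeps the level function. [cite: Balaban1984PropagatorsII, (2.3)–(2.4) p.224] -/
@[simp] theorem ofBox_lev (D₁ : B6MultiLevelBoxOperator.Domains d ℓ Mh k P R) : (ofBox D₁).lev = D₁.lev := rfl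

/-- **THE TRIVIAL MEMBER** `Ω₁ = … = Ω_k = X` (every site at level `k`): inhabited for every parameter set, `k = 0` included (then
`Λ₀ = X`). [cite: Balaban1984PropagatorsII, (2.1) p.224 (the one-domain sequence)] -/
def top (d ℓ Mh k : ℕ) (P : Fin (d + 1) → ℕ) (R : ℕ) : Domains d ℓ Mh k P R where
  lev := fun _ => k
  lev_le := fun _ => le_rfl
  bigBlocks := fun _ _ _ _ _ _ _ => Iff.rfl
  sep := fun j x _ x' _ (h1 : k < j) (h2 : j + 1 ≤ k) => by exfalso; omega

/-- **THE FLOOR MEMBER** `Ω₁ = ∅` (every site at level `0`, `Λ₀ = X`): the pure lattice-scale mass `−Δ^N_X + a₀` of p. 229 («+∞ outside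
Ω₁»). [cite: Balaban1984PropagatorsII, (2.3)–(2.4) p.224 («Λ₀ = Ω₁^c»), p.229] -/
def floor (d ℓ Mh k : ℕ) (P : Fin (d + 1) → ℕ) (R : ℕ) : Domains d ℓ Mh k P R where
  lev := fun _ => 0
  lev_le := fun _ => Nat.zero_le _
  bigBlocks := fun _ _ _ _ _ _ _ => Iff.rfl
  sep := fun j x _ x' _ (h1 : 0 < j) (h2 : j + 1 ≤ 0) => by exfalso; omega

/-- **A TWO-LEVEL `0/1` MEMBER WITH `Λ₀ ≠ ∅` IN GENERAL**: for `k = 1` and ANY set `S` of big-`1`-block indices, the family with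
`Ω₁ = ⋃_{β∈S}` (big `1`-block `β`), `Λ₀ = X ∖ Ω₁` — (2.1) holds by construction and (2.2) is vacuous (there is no level `2`): print's
«smallest possible domains» at one step. [cite: Balaban1984PropagatorsII, (2.1)–(2.2) p.224 with p.229] -/
def split01 (d ℓ Mh : ℕ) (P : Fin (d + 1) → ℕ) (R : ℕ) (S : Set (Fin (d + 1) → ℤ)) [DecidablePred (· ∈ S)] :
    Domains d ℓ Mh 1 P R where
  lev := fun x => if blk (bigSide ℓ Mh 1) x ∈ S then 1 else 0
  lev_le := fun x => by split_ifs <;> omega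
  bigBlocks := fun j hj x _ x' _ h => by
    rcases Nat.lt_or_ge 1 j with hlt | hle
    · constructor <;> intro h' <;> exfalso <;> split_ifs at h' <;> omega
    · have hj1 : j = 1 := le_antisymm hle hj
      subst hj1
      simp only [h]
  sep := fun j x _ x' _ h1 h2 => by exfalso; split_ifs at h1 h2 <;> omega

/-- the level of `split01` is `1` exactly on the chosen big `1`-blocks. [cite: Balaban1984PropagatorsII, (2.1) p.224] -/
theorem split01_lev (d ℓ Mh : ℕ) (P : Fin (d + 1) → ℕ) (R : ℕ) (S : Set (Fin (d + 1) → ℤ)) [DecidablePred (· ∈ S)]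
    (x : Fin (d + 1) → ℤ) : (split01 d ℓ Mh P R S).lev x = if blk (bigSide ℓ Mh 1) x ∈ S then 1 else 0 := rfl

/-- the territory `B^j(Λ_j) = {lev = j}` and the domain `Ω_j = {j ≤ lev}`, as predicates. [cite: Balaban1984PropagatorsII, (2.3)–(2.4) p.224] -/
def terr (j : ℕ) (x : Fin (d + 1) → ℤ) : Prop := D.lev x = j

/-- (2.3)–(2.4): `x ∈ Ω_j ⇔ j ≤ lev x`; in particular `Ω₀ = X`, `Ω_j ⊃ Ω_{j+1}` and the territories partition `X`.
[cite: Balaban1984PropagatorsII, (2.3)–(2.4) p.224] -/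
def omega (j : ℕ) (x : Fin (d + 1) → ℤ) : Prop := j ≤ D.lev x

/-- nesting (2.1): `Ω_{j+1} ⊂ Ω_j`. [cite: Balaban1984PropagatorsII, (2.1) p.224] -/
theorem omega_succ_subset (j : ℕ) (x : Fin (d + 1) → ℤ) (h : D.omega (j + 1) x) : Domains.omega D j x :=
  le_trans (Nat.le_succ j) h

/-- `Ω₀ = X` («B⁰(Λ₀) = Λ₀», every site lies in some territory). [cite: Balaban1984PropagatorsII, (2.4) p.224] -/
theorem omega_zero (x : Fin (d + 1) → ℤ) : D.omega 0 x := Nat.zero_le _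

/-- (2.3): `Λ_j`-territory `= Ω_j ∖ Ω_{j+1}` (at `j = 0`: `Λ₀ = Ω₁^c`). [cite: Balaban1984PropagatorsII, (2.3) p.224] -/
theorem terr_iff (j : ℕ) (x : Fin (d + 1) → ℤ) : Domains.terr D j x ↔ D.omega j x ∧ ¬ D.omega (j + 1) x := by
  unfold terr omega; omega

/-- `Λ₀ = Ω₁^c`: level `0` iff not in `Ω₁`. [cite: Balaban1984PropagatorsII, (2.3) p.224 («Λ₀ = Ω₁^c»)] -/
theorem terr_zero_iff (x : Fin (d + 1) → ℤ) : D.terr 0 x ↔ ¬ D.omega 1 x := by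
  unfold terr omega; omega

/-- **EVERY TERRITORY IS A UNION OF BLOCKS OF ITS OWN LEVEL** (from (2.1) at levels `j` and `j + 1`; at level `0` the block is the site
itself): two sites of the box in the same `L^{lev x}`-block have the same level. [cite: Balaban1984PropagatorsII, (2.1)+(2.3) p.224] -/
theorem lev_eq_of_blk_eq {x x' : Fin (d + 1) → ℤ} (hx : x ∈ boxDom (N0 ℓ Mh k P)) (hx' : x' ∈ boxDom (N0 ℓ Mh k P))
    (h : blk ((ℓ + 1) ^ D.lev x) x' = blk ((ℓ + 1) ^ D.lev x) x) : Domains.lev D x' = D.lev x := by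
  have hb1 : blk (bigSide ℓ Mh (D.lev x)) x' = blk (bigSide ℓ Mh (D.lev x)) x := by
    rw [bigSide_eq, ← blk_blk (Mh * (ℓ + 1)) ((ℓ + 1) ^ D.lev x) x',
      ← blk_blk (Mh * (ℓ + 1)) ((ℓ + 1) ^ D.lev x) x, h]
  have hb2 : blk (bigSide ℓ Mh (D.lev x + 1)) x' = blk (bigSide ℓ Mh (D.lev x + 1)) x := by
    rw [bigSide_succ_eq, ← blk_blk (Mh * (ℓ + 1) ^ 2) ((ℓ + 1) ^ D.lev x) x',
      ← blk_blk (Mh * (ℓ + 1) ^ 2) ((ℓ + 1) ^ D.lev x) x, h]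
  have hge : D.lev x ≤ D.lev x' := by
    rcases Nat.lt_or_ge 0 (D.lev x) with hlt | hle
    · exact (D.bigBlocks (D.lev x) hlt x hx x' hx' hb1).1 le_rfl
    · exact le_trans hle (Nat.zero_le _)
  have hle : D.lev x' ≤ D.lev x := by
    by_contra hlt
    have h2 : D.lev x + 1 ≤ D.lev x' := by omega
    have h3 := (D.bigBlocks (D.lev x + 1) (by omega) x hx x' hx' hb2).2 h2
    omega
  exact le_antisymm hle hge

/-- the same, for the block side of an arbitrary level `i ≤ lev x` (a territory is a union of finer blocks too).
[cite: Balaban1984PropagatorsII, (2.1)+(2.3) p.224] -/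
theorem lev_eq_of_blk_eq_of_le {x x' : Fin (d + 1) → ℤ} (hx : x ∈ boxDom (N0 ℓ Mh k P))
    (hx' : x' ∈ boxDom (N0 ℓ Mh k P)) {i : ℕ} (hi : i ≤ D.lev x)
    (h : blk ((ℓ + 1) ^ i) x' = blk ((ℓ + 1) ^ i) x) : D.lev x' = D.lev x := by
  refine D.lev_eq_of_blk_eq hx hx' ?_
  obtain ⟨t, ht⟩ := Nat.exists_eq_add_of_le hi
  rw [ht, pow_add, ← blk_blk, ← blk_blk, h]

/-! ### The two-level window of a cube (p. 230 «□ … intersecting maybe the domain B^{j+1}(Λ_{j+1})»), level `0` included -/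

/-- **LEVELS SEEN FROM A `j`-CUBE**: for `R ≥ 2L`, a site within sup-distance `< 2ML^j` of a site of `B^j(Λ_j)` has level `j − 1`, `j`
or `j + 1` (for `j = 0`: level `0` or `1`). [cite: Balaban1984PropagatorsII, (2.2) p.224 with p.230 («intersecting maybe the domain B^{j+1}(Λ_{j+1})»)] -/
theorem lev_window (hR : 2 * (ℓ + 1) ≤ R) {t x : Fin (d + 1) → ℤ} (ht : t ∈ boxDom (N0 ℓ Mh k P))
    (hx : x ∈ boxDom (N0 ℓ Mh k P)) {j : ℕ} (htj : D.lev t = j)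
    (hxt : supNorm (x - t) < 2 * (bigSide ℓ Mh j : ℝ)) : j ≤ D.lev x + 1 ∧ D.lev x ≤ j + 1 := by
  have hL1 : (1 : ℝ) ≤ (ℓ : ℝ) + 1 := by
    have : (0 : ℝ) ≤ ℓ := by positivity
    linarith
  have hR' : (2 : ℝ) * ((ℓ : ℝ) + 1) ≤ R := by exact_mod_cast hR
  have hR2 : (2 : ℝ) ≤ R := by nlinarith
  have hbs : ∀ i : ℕ, (0 : ℝ) ≤ (bigSide ℓ Mh i : ℝ) := fun i => by positivity
  constructor
  · by_contra hlt
    push Not at hlt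
    -- `lev x + 2 ≤ j`, so `j ≥ 1`: apply (2.2) at level `j - 1` to the pair `(x, t)`
    obtain ⟨i, rfl⟩ : ∃ i, j = i + 1 := ⟨j - 1, by omega⟩
    have hsep := D.sep i x hx t ht (by omega) (by omega)
    have e : (bigSide ℓ Mh (i + 1) : ℝ) = ((ℓ : ℝ) + 1) * bigSide ℓ Mh i := by
      rw [bigSide_succ]; push_cast; ring
    rw [e] at hxt
    have h1 : ((R * bigSide ℓ Mh i : ℕ) : ℝ) = (R : ℝ) * bigSide ℓ Mh i := by push_cast; ring
    rw [h1] at hsep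
    nlinarith [hbs i]
  · by_contra hlt
    push Not at hlt
    -- `j + 2 ≤ lev x`: apply (2.2) at level `j + 1` to the pair `(t, x)`
    have hsep := D.sep (j + 1) t ht x hx (by omega) (by omega)
    have e : (bigSide ℓ Mh (j + 1) : ℝ) = ((ℓ : ℝ) + 1) * bigSide ℓ Mh j := by
      rw [bigSide_succ]; push_cast; ring
    have h1 : ((R * bigSide ℓ Mh (j + 1) : ℕ) : ℝ) = (R : ℝ) * (((ℓ : ℝ) + 1) * bigSide ℓ Mh j) := by
      rw [← e]; push_cast; ring
    rw [h1] at hsep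
    have hsym : supNorm (t - x) = supNorm (x - t) := by
      rw [← B4TorusKernel.supNorm_neg, neg_sub]
    rw [hsym] at hsep
    nlinarith [hbs j]

/-- **NEVER BOTH NEIGHBOURING LEVELS**: for `R ≥ 2L`, two sites within `< 2ML^j` of a common site cannot have levels `j − 1` and `j + 1`
(by (2.2) at level `j`, `R ≥ 4`). [cite: Balaban1984PropagatorsII, (2.2) p.224 with p.230] -/
theorem not_both_sides (hℓ : 1 ≤ ℓ) (hR : 2 * (ℓ + 1) ≤ R) {t x x' : Fin (d + 1) → ℤ}
    (hx : x ∈ boxDom (N0 ℓ Mh k P)) (hx' : x' ∈ boxDom (N0 ℓ Mh k P)) {j : ℕ}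
    (hxt : supNorm (x - t) < 2 * (bigSide ℓ Mh j : ℝ)) (hx't : supNorm (x' - t) < 2 * (bigSide ℓ Mh j : ℝ))
    (hlx : D.lev x + 1 = j) (hlx' : D.lev x' = j + 1) : False := by
  have hR4 : (4 : ℝ) ≤ R := by
    have : 4 ≤ R := by omega
    exact_mod_cast this
  have hsep := D.sep j x hx x' hx' (by omega) (by omega)
  have h1 : ((R * bigSide ℓ Mh j : ℕ) : ℝ) = (R : ℝ) * bigSide ℓ Mh j := by push_cast; ring
  rw [h1] at hsep
  have htri : supNorm (x - x') ≤ supNorm (x - t) + supNorm (t - x') := supNorm_sub_le_sub_add_sub x t x'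
  have hsym : supNorm (t - x') = supNorm (x' - t) := by rw [← B4TorusKernel.supNorm_neg, neg_sub]
  rw [hsym] at htri
  have hbs : (0 : ℝ) ≤ (bigSide ℓ Mh j : ℝ) := by positivity
  nlinarith

/-- `Λ₀` and `Ω₂` are far apart: a level-`0` site and a site of level `≥ 2` are more than `R·M·L` apart ((2.2) at `j = 1`, the only
separation print imposes around `Λ₀`; nothing separates `Λ₀` from `Λ₁` beyond (2.1)). [cite: Balaban1984PropagatorsII, (2.2) p.224] -/
theorem sep_zero_two {x x' : Fin (d + 1) → ℤ} (hx : x ∈ boxDom (N0 ℓ Mh k P)) (hx' : x' ∈ boxDom (N0 ℓ Mh k P))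
    (h0 : D.lev x = 0) (h2 : 2 ≤ D.lev x') : ((R * bigSide ℓ Mh 1 : ℕ) : ℝ) < supNorm (x - x') :=
  D.sep 1 x hx x' hx' (by omega) (by omega)

end Domains

/-! ## §3 The entries of the `k`-level operator `Δ′_a` (2.13)–(2.14) for a family with level `0` -/

/-- at level `0` the coefficient of (2.14) is the bare weight: `levC d ℓ a 0 = a₀` (`(L⁰)^{−2}·(L⁰)^{−(d+1)} = 1`).
[cite: Balaban1984PropagatorsII, (2.14) p.225 («the index j running from 0 to k»)] -/
theorem levC_zero (d ℓ : ℕ) (a : ℕ → ℝ) : levC d ℓ a 0 = a 0 := by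
  simp [levC]

section Apply

variable {ℓ Mh k R : ℕ} {P : Fin (d + 1) → ℕ} (D : Domains d ℓ Mh k P R)

/-- **ENTRIES OF `Δ′_a`** (the lineage's `B6MultiLevelBoxOperator.mlOp`, which already sums the levels `0, …, k`) on any presentation
`N = N₀` of the box, for a family WITH level `0`: `Δ′_a(x, x′) = (−Δ^N_X)(x, x′) + levC_{lev x}·[x′ ∼_{lev x} x]` — the sum over levels
collapses to the level of `x` because territories are unions of blocks of their own level (`Domains.lev_eq_of_blk_eq`).
[cite: Balaban1984PropagatorsII, (2.13)–(2.14) p.225] -/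
theorem mlOp_apply {N : Fin (d + 1) → ℕ} (hN : N = N0 ℓ Mh k P) (a : ℕ → ℝ) (x y : ↥(boxDom N)) :
    mlOp N ℓ k D.lev a x y
      = neumannLapK N x.1 y.1 + avgK (levC d ℓ a (D.lev x.1)) ((ℓ + 1) ^ D.lev x.1) x.1 y.1 := by
  have hx : x.1 ∈ boxDom (N0 ℓ Mh k P) := hN ▸ x.2
  have hy : y.1 ∈ boxDom (N0 ℓ Mh k P) := hN ▸ y.2
  -- the embedded level function of `D` restricted to nothing: we re-run the twin's computation with the new block lemma
  unfold mlOp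
  rw [Matrix.add_apply, Matrix.sum_apply]
  have hlap : opBoxR 1 0 0 1 N x y = neumannLapK N x.1 y.1 := by
    simp [opBoxR, B4BoxCov237.opBoxR, diagK, avgK]
  rw [hlap]
  congr 1
  have hpiece : ∀ (j b : ℕ), (Matrix.diagonal (indLev N D.lev j) * opBoxR 0 0 1 b N * Matrix.diagonal (indLev N D.lev j)) x y
      = if D.lev x.1 = j ∧ D.lev y.1 = j ∧ blk b y.1 = blk b x.1 then 1 else 0 := by
    intro j b
    rw [Matrix.mul_diagonal, Matrix.diagonal_mul]
    have havg : opBoxR 0 0 1 b N x y = if blk b y.1 = blk b x.1 then 1 else 0 := by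
      simp [opBoxR, B4BoxCov237.opBoxR, diagK, avgK, neumannLapK]
    rw [havg]
    unfold indLev
    by_cases h1 : D.lev x.1 = j <;> by_cases h2 : D.lev y.1 = j <;> by_cases h3 : blk b y.1 = blk b x.1 <;> simp [h1, h2, h3]
  have hterm : ∀ j, (levC d ℓ a j • (Matrix.diagonal (indLev N D.lev j) * opBoxR 0 0 1 ((ℓ + 1) ^ j) N
      * Matrix.diagonal (indLev N D.lev j))) x y
      = if D.lev x.1 = j ∧ D.lev y.1 = j ∧ blk ((ℓ + 1) ^ j) y.1 = blk ((ℓ + 1) ^ j) x.1 then levC d ℓ a j else 0 := by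
    intro j
    rw [Matrix.smul_apply, smul_eq_mul, hpiece]
    split_ifs <;> simp
  simp_rw [hterm]
  unfold avgK
  by_cases hb : blk ((ℓ + 1) ^ D.lev x.1) y.1 = blk ((ℓ + 1) ^ D.lev x.1) x.1
  · rw [if_pos hb]
    have hly : D.lev y.1 = D.lev x.1 := D.lev_eq_of_blk_eq hx hy hb
    rw [Finset.sum_eq_single (D.lev x.1)]
    · rw [if_pos ⟨rfl, hly, hb⟩]
    · intro j _ hj
      rw [if_neg]
      rintro ⟨h1, -, -⟩
      exact hj h1.symm
    · intro h
      exact absurd (Finset.mem_range.2 (Nat.lt_succ_of_le (D.lev_le x.1))) h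
  · rw [if_neg hb]
    refine Finset.sum_eq_zero fun j _ => ?_
    rw [if_neg]
    rintro ⟨h1, -, h3⟩
    rw [← h1] at h3
    exact hb h3

/-- **THE LEVEL-`0` ROWS OF `Δ′_a`**: for `x ∈ Λ₀`, `Δ′_a(x, x′) = (−Δ^N_X)(x, x′) + a₀·δ_{xx′}` — the lattice-scale mass of p. 229
(«+∞ outside Ω₁» in the continuum reading), print's «(Q′₀λ)(x) = λ(x), x ∈ Λ₀». [cite: Balaban1984PropagatorsII, (2.14) p.225, p.229] -/
theorem mlOp_apply_of_lev_zero {N : Fin (d + 1) → ℕ} (hN : N = N0 ℓ Mh k P) (a : ℕ → ℝ) (x y : ↥(boxDom N))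
    (h0 : D.lev x.1 = 0) :
    mlOp N ℓ k D.lev a x y = neumannLapK N x.1 y.1 + (if y = x then a 0 else 0) := by
  rw [mlOp_apply D hN a x y, h0, levC_zero, pow_zero]
  unfold avgK
  rw [blk_one, blk_one]
  by_cases hxy : y = x
  · rw [if_pos (congrArg Subtype.val hxy), if_pos hxy]
  · rw [if_neg (fun h => hxy (Subtype.ext h)), if_neg hxy]

/-- on an embedded family of the twin structure the operator is literally the twin's (same level function).
[cite: Balaban1984PropagatorsII, (2.13)–(2.14) p.225] -/
theorem mlOp_ofBox (N : Fin (d + 1) → ℕ) (a : ℕ → ℝ) (D₁ : B6MultiLevelBoxOperator.Domains d ℓ Mh k P R) :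
    mlOp N ℓ k (Domains.ofBox D₁).lev a = mlOp N ℓ k D₁.lev a := rfl

/-- … and so is its inverse `G′ = Δ′_a⁻¹`. [cite: Balaban1984PropagatorsII, p.225 («G′ = Δ′_a^{−1}»)] -/
theorem gml_ofBox (N : Fin (d + 1) → ℕ) (a : ℕ → ℝ) (D₁ : B6MultiLevelBoxOperator.Domains d ℓ Mh k P R) :
    gml N ℓ k (Domains.ofBox D₁).lev a = gml N ℓ k D₁.lev a := rfl

/-- the hypothesis `lev ≤ k` under which the lineage's inverse `gml` is the two-sided inverse of `Δ′_a`
(`B6MultiLevelBoxOperator.mlOp_mul_gml`), read off the structure. [cite: Balaban1984PropagatorsII, p.225 («G′ = Δ′_a^{−1} is a well defined, positive operator»)] -/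
theorem lev_le_k : ∀ x, D.lev x ≤ k := D.lev_le

end Apply

end

end Literature.MathematicalPhysics.QuantumFieldTheory.Balaban1983to89.B6MultiLevelBoxOperatorL0
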